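import Summits.BirchSwinnertonDyer.Rank1Residual.Iwasawa.RankGrowthLayer
import Literature.NumberTheory.NumberFields.CubicFieldExplicit
import Literature.Barriers.BirchSwinnertonDyer.RankNotSumOfLocalInvariantsF3CubicPolys
import Literature.Barriers.BirchSwinnertonDyer.RankNotSumOfLocalInvariantsC3C3Proofs
import Literature.NumberTheory.EllipticCurves.ComplexMultiplicationCoatesWilesReductionIndexProofs
import Literature.NumberTheory.EllipticCurves.ComplexMultiplicationCoatesWilesSeparationProofs
import Literature.NumberTheory.EllipticCurves.PadicFormalLogOrder
import Literature.NumberTheory.EllipticCurves.AnalyticRankOverNumberFieldProofs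
import Mathlib.NumberTheory.Padics.Hensel
import Mathlib.LinearAlgebra.Dimension.RankNullity
import Mathlib.LinearAlgebra.Dimension.Localization
import Mathlib.Tactic.Module
import HarnessLib

/-!
# Layer-1 rank certificates: `LayerRankGEAt W 3 1 (r + 2)` IN THE KERNEL from `r ≤ rank E(ℚ)` and ONE
# point `Q ∈ E(ℚ(ζ₉)⁺)` with `Q − σQ` of infinite order (cell `bsd-eis`, seat `bsd-eis-k5-c3` gen 5; THEOREMS ONLY)

HONEST FRAMING (FULL-BSD rank-≤1 programme D-0033, cell `bsd-eis`, `run/shared/lean/pub/bsd-eis/`; rung K5, crux 3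
`MazurMCOnCellB` = stmt-BirchSwinnertonDyer-19033, row A10-split). Nothing booked, no label moves. The nine
road-T1 displays of planner FINDING F9 (`X2/RouteGSplitDisplay<T>.lean`, T ∈ {103206a1, 323214e1, 152880ce1,
336336ij1, 397488if1, 235200xd1, 368610f1, 387930e1, 387930f1}) carry ONE certificate binder beyond the refereed
T-EISRG3 profile: `hm' : Iwasawa.LayerRankGEAt W' 3 1 m` («`m ≤ rank E'(ℚ₁)`», `ℚ₁ = ℚ(ζ₉)⁺`, `m = r' + 2`),
the «KERNEL GAP at the certificate level» of `Iwasawa/RankGrowthLayer.lean`. This file is the kernel checker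
that discharges it; the per-relative certificates are in `X2/LayerOneRank<relative>.lean`.

THE MATHEMATICS (F9-FINDING §3, written out). Let `K` be a number field with `[K : ℚ] = 3`, `θ ∈ K` a root of
`t³ − 3t + 1` and `σ : K → K` a ring endomorphism with `σθ = θ² − 2` (then `σ³ = 1`: `K = ℚ(θ)` and
`σ³θ = θ`). For `E/ℚ`, `σ` acts on `E(K)` by transport of coordinates (Mathlib `Point.map`), fixing `E(ℚ)`.
If `P₁, …, P_r ∈ E(ℚ)` are `ℤ`-independent and `Q ∈ E(K)` has `D := Q − σQ` of infinite order, then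
`P₁, …, P_r, D, σD` are `ℤ`-independent in `E(K)`: a relation `Σ aᵢPᵢ + bD + cσD = 0` gives, applying `1 − σ`
and using `D + σD + σ²D = Q − σ³Q = 0`, `(b + c)D + (2c − b)σD = 0`; a relation `xD + yσD = 0` gives (apply `σ`,
eliminate `σD`) `(x² − xy + y²)D = 0`, and `x² − xy + y² = 3(b² − bc + c²) > 0` unless `b = c = 0`; then
`Σ aᵢPᵢ = 0` in `E(K) ⊇ E(ℚ)`. Hence `r + 2 ≤ rank_ℤ E(K)` (Mordell–Weil over `K`, tree theorem
`WeierstrassCurve.module_finite_point_holds`). The infinite order of `D` is certified `ℓ`-adically: for a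
prime `ℓ ≥ 5` of good reduction with a root of `t³ − 3t + 1` in `ℤ_ℓ` (Hensel; `ℓ ≡ ±1 (mod 9)`), the power
basis `1, θ, θ²` (`MonicCubic.pb`) gives `K →ₐ[ℚ] ℚ_ℓ`, so a torsion point `T ∈ E(K)` maps to a torsion point
of `E(ℚ_ℓ)`, and `N_ℓ • T ∈ E₁(ℚ_ℓ)` (AEC VII.2.1, tree `isInReductionKernel_reductionPointCount_nsmul`) is
torsion in the torsion-free `E₁(ℚ_ℓ)` (AEC IV.6.1/VII.3.1, tree `eq_zero_of_isOfFinAddOrder_of_isInReductionKernel`),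
so `N_ℓ • T = 0`; two primes give `gcd(N_ℓ₁, N_ℓ₂) • T = 0`, refuted for `T = D` by an explicit small multiple.
Finally `κ.layer 1` (any cyclotomic `κ : ZpExtension ℚ 3`) IS such a `K` (`CyclotomicLayerOneCubic.lean` +
`ZpExtension.finrank_layer_holds`), which turns `r + 2 ≤ rank E(K)` for all such `K` into `LayerRankGEAt W 3 1 (r + 2)`.

Also here: field-generic chord / tangent / negation certificate lemmas (the `ℚ`-versions are x10b's
`Supersingular/RationalLadder.lean`), used by the per-relative files to compute `D`, `2D` explicitly in `K`.

References: J. H. Silverman, *The Arithmetic of Elliptic Curves*, 2nd ed. (2009), III.2.3 (group law),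
IV.6.1, VII.2.1, VII.3.1, VIII.6.7 [SilvermanAEC2009]; R. Greenberg, LNM 1716 (1999) Thm. 1.9 (the consumer of
`LayerRankGEAt`) [GreenbergLNM1716]; L. C. Washington, *Introduction to Cyclotomic Fields* §13.1 [Washington1997].
-/

noncomputable section

open scoped Classical

open Module Polynomial WeierstrassCurve WeierstrassCurve.Affine
  Literature.NumberTheory.EllipticCurves Literature.NumberTheory.NumberFields
  Literature.Barriers.BirchSwinnertonDyer.DokchitserDokchitser2011

set_option autoImplicit false

namespace Summit.BirchSwinnertonDyer.Rank1Residual.Iwasawa.LayerOneRank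

/-! ## §1 Chord, tangent and negation with supplied slopes, over any field -/

section GroupLaw

variable {F : Type*} [Field F] {W : WeierstrassCurve F}

/-- Two affine points with equal coordinates are equal (proof irrelevance). [folklore] -/
theorem exists_some_eq_of_eq {x y x' y' : F} (h : W.toAffine.Nonsingular x y) (hx : x = x') (hy : y = y') :
    ∃ h' : W.toAffine.Nonsingular x' y',
      (Point.some x y h : W.toAffine.Point) = Point.some x' y' h' := by
  subst hx hy; exact ⟨h, rfl⟩

/-- **Chord with a supplied slope**: `x₁ ≠ x₂`, `L (x₁ − x₂) = y₁ − y₂`, `x₃ = L² + a₁L − a₂ − x₁ − x₂`,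
`y₃ = −(L (x₃ − x₁) + y₁) − a₁ x₃ − a₃` ⟹ `(x₁,y₁) + (x₂,y₂) = (x₃,y₃)`. [cite: SilvermanAEC2009, III.2.3] -/
theorem some_add_some_eq {x₁ y₁ x₂ y₂ L x₃ y₃ : F} (h₁ : W.toAffine.Nonsingular x₁ y₁)
    (h₂ : W.toAffine.Nonsingular x₂ y₂) (hx : x₁ ≠ x₂) (hL : L * (x₁ - x₂) = y₁ - y₂)
    (hx₃ : x₃ = L ^ 2 + W.a₁ * L - W.a₂ - x₁ - x₂) (hy₃ : y₃ = -(L * (x₃ - x₁) + y₁) - W.a₁ * x₃ - W.a₃) :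
    ∃ h₃ : W.toAffine.Nonsingular x₃ y₃,
      (Point.some x₁ y₁ h₁ : W.toAffine.Point) + Point.some x₂ y₂ h₂ = Point.some x₃ y₃ h₃ := by
  have hslope : W.toAffine.slope x₁ x₂ y₁ y₂ = L := by
    rw [Affine.slope_of_X_ne hx, div_eq_iff (sub_ne_zero.mpr hx), hL]
  rw [Affine.Point.add_of_X_ne hx]
  refine exists_some_eq_of_eq _ ?_ ?_
  · rw [hslope, hx₃]; simp only [Affine.addX]
  · rw [hslope, hy₃, hx₃]
    simp only [Affine.addY, Affine.negAddY, Affine.addX, Affine.negY]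

/-- **Tangent with a supplied slope**: `2y₁ + a₁x₁ + a₃ ≠ 0`, `L (2y₁ + a₁x₁ + a₃) = 3x₁² + 2a₂x₁ + a₄ − a₁y₁`,
`x₃ = L² + a₁L − a₂ − 2x₁`, `y₃ = −(L (x₃ − x₁) + y₁) − a₁x₃ − a₃` ⟹ `2·(x₁,y₁) = (x₃,y₃)`.
[cite: SilvermanAEC2009, III.2.3] -/
theorem some_add_self_eq {x₁ y₁ L x₃ y₃ : F} (h₁ : W.toAffine.Nonsingular x₁ y₁)
    (hD : 2 * y₁ + W.a₁ * x₁ + W.a₃ ≠ 0)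
    (hL : L * (2 * y₁ + W.a₁ * x₁ + W.a₃) = 3 * x₁ ^ 2 + 2 * W.a₂ * x₁ + W.a₄ - W.a₁ * y₁)
    (hx₃ : x₃ = L ^ 2 + W.a₁ * L - W.a₂ - x₁ - x₁) (hy₃ : y₃ = -(L * (x₃ - x₁) + y₁) - W.a₁ * x₃ - W.a₃) :
    ∃ h₃ : W.toAffine.Nonsingular x₃ y₃,
      (Point.some x₁ y₁ h₁ : W.toAffine.Point) + Point.some x₁ y₁ h₁ = Point.some x₃ y₃ h₃ := by
  have hDval : y₁ - W.toAffine.negY x₁ y₁ = 2 * y₁ + W.a₁ * x₁ + W.a₃ := by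
    simp only [Affine.negY]; ring
  have hy : y₁ ≠ W.toAffine.negY x₁ y₁ := by
    intro h; apply hD; rw [← hDval, sub_eq_zero.mpr h]
  have hslope : W.toAffine.slope x₁ x₁ y₁ y₁ = L := by
    rw [Affine.slope_of_Y_ne rfl hy, hDval, div_eq_iff hD, hL]
  rw [Affine.Point.add_self_of_Y_ne hy]
  refine exists_some_eq_of_eq _ ?_ ?_
  · rw [hslope, hx₃]; simp only [Affine.addX]
  · rw [hslope, hy₃, hx₃]
    simp only [Affine.addY, Affine.negAddY, Affine.addX, Affine.negY]

/-- **A doubled point is non-zero** when `2y₁ + a₁x₁ + a₃ ≠ 0` (the tangent is not vertical).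
[cite: SilvermanAEC2009, III.2.3] -/
theorem two_nsmul_ne_zero {x₁ y₁ : F} (h₁ : W.toAffine.Nonsingular x₁ y₁)
    (hD : 2 * y₁ + W.a₁ * x₁ + W.a₃ ≠ 0) :
    (2 : ℕ) • (Point.some x₁ y₁ h₁ : W.toAffine.Point) ≠ 0 := by
  have hDval : y₁ - W.toAffine.negY x₁ y₁ = 2 * y₁ + W.a₁ * x₁ + W.a₃ := by
    simp only [Affine.negY]; ring
  have hy : y₁ ≠ W.toAffine.negY x₁ y₁ := by
    intro h; apply hD; rw [← hDval, sub_eq_zero.mpr h]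
  rw [two_nsmul, Affine.Point.add_self_of_Y_ne hy]
  exact Affine.Point.some_ne_zero _

/-- **A sum of two affine points with distinct `x` is non-zero.** [cite: SilvermanAEC2009, III.2.3] -/
theorem some_add_some_ne_zero {x₁ y₁ x₂ y₂ : F} (h₁ : W.toAffine.Nonsingular x₁ y₁)
    (h₂ : W.toAffine.Nonsingular x₂ y₂) (hx : x₁ ≠ x₂) :
    (Point.some x₁ y₁ h₁ : W.toAffine.Point) + Point.some x₂ y₂ h₂ ≠ 0 := by
  rw [Affine.Point.add_of_X_ne hx]
  exact Affine.Point.some_ne_zero _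

/-- **Negation**: `−(x, y) = (x, −y − a₁x − a₃)`. [cite: SilvermanAEC2009, III.2.3] -/
theorem neg_some_eq {x y y' : F} (h : W.toAffine.Nonsingular x y) (hy' : y' = -y - W.a₁ * x - W.a₃) :
    ∃ h' : W.toAffine.Nonsingular x y', -(Point.some x y h : W.toAffine.Point) = Point.some x y' h' := by
  subst hy'
  exact ⟨_, Affine.Point.neg_some h⟩

/-- A unit is non-zero: `u v = 1 ⟹ u ≠ 0` (the Bezout certificate for `u ≠ 0` in `ℚ(θ)`). [folklore] -/
theorem ne_zero_of_mul_eq_one {u v : F} (h : u * v = 1) : u ≠ 0 := left_ne_zero_of_mul_eq_one h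

/-- `a ≠ b` from a Bezout certificate `(a − b) v = 1`. [folklore] -/
theorem ne_of_sub_mul_eq_one {a b v : F} (h : (a - b) * v = 1) : a ≠ b :=
  sub_ne_zero.mp (left_ne_zero_of_mul_eq_one h)

end GroupLaw

/-! ## §2 Torsion control in `E(K)`, `K` a cubic field with a root of `t³ − 3t + 1`, through `K → ℚ_ℓ` -/

section Torsion

/-- `t³ − 3t + 1` is irreducible over `ℚ` (rational root test: `±1` are not roots). [folklore] -/
theorem irreducible_polyQ : Irreducible (MonicCubic.polyQ 0 (-3) 1) := by
  rw [MonicCubic.polyQ_eq]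
  have := irreducible_cubic_of_forall_int_dvd (a := 0) (b := -3) (c := 1) fun n hn => by
    have h1 : n = 1 ∨ n = -1 := by
      rcases Int.isUnit_iff.mp (isUnit_of_dvd_one hn) with h | h <;> simp [h]
    rcases h1 with rfl | rfl <;> norm_num
  exact_mod_cast this

variable {K : Type*} [Field K] [NumberField K] {θ : K}

omit [NumberField K] in
/-- A root of `t³ − 3t + 1` in the `MonicCubic.poly` normal form. [folklore] -/
theorem aeval_poly_eq_zero (hθ : θ ^ 3 - 3 * θ + 1 = 0) : aeval θ (MonicCubic.poly 0 (-3) 1) = 0 := by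
  simp only [MonicCubic.poly, map_add, map_mul, map_pow, aeval_X, eq_intCast, map_intCast]
  push_cast
  linear_combination hθ

/-- **`K = ℚ(θ) → ℚ_ℓ` from a root of `t³ − 3t + 1` in `ℚ_ℓ`** (`[K : ℚ] = 3`; the power basis `1, θ, θ²`
of `MonicCubic.pb`, Mathlib `PowerBasis.lift`). [folklore] -/
theorem exists_algHom_padic (h3 : finrank ℚ K = 3) (hθ : θ ^ 3 - 3 * θ + 1 = 0)
    (ℓ : ℕ) [Fact ℓ.Prime] (t : ℚ_[ℓ]) (ht : t ^ 3 - 3 * t + 1 = 0) :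
    ∃ φ : K →ₐ[ℚ] ℚ_[ℓ], φ θ = t := by
  have hθ' := aeval_poly_eq_zero hθ
  let pb := MonicCubic.pb irreducible_polyQ hθ' h3
  have hgen : pb.gen = θ := MonicCubic.pb_gen irreducible_polyQ hθ' h3
  have hmin : minpoly ℚ pb.gen = MonicCubic.polyQ 0 (-3) 1 := by
    rw [hgen]; exact MonicCubic.minpoly_rat_eq irreducible_polyQ hθ'
  have ht' : aeval t (minpoly ℚ pb.gen) = 0 := by
    rw [hmin, MonicCubic.polyQ_eq]
    simp only [map_add, map_mul, map_pow, aeval_X, aeval_C, eq_ratCast]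
    push_cast
    linear_combination ht
  exact ⟨pb.lift t ht', by rw [← hgen]; exact pb.lift_gen t ht'⟩

/-- **A root of `t³ − 3t + 1` in `ℤ_ℓ` by Hensel's lemma** from an integer `a` with `ℓ ∣ a³ − 3a + 1` and
`ℓ ∤ 3a² − 3` (i.e. a simple root mod `ℓ`; such `a` exists iff `ℓ ≡ ±1 (mod 9)` or `ℓ = 3`). [folklore] -/
theorem exists_padicInt_root (ℓ : ℕ) [Fact ℓ.Prime] (a : ℤ) (h1 : (ℓ : ℤ) ∣ a ^ 3 - 3 * a + 1)
    (h2 : ¬ (ℓ : ℤ) ∣ 3 * a ^ 2 - 3) : ∃ t : ℚ_[ℓ], t ^ 3 - 3 * t + 1 = 0 := by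
  set F : Polynomial ℤ := X ^ 3 - 3 * X + 1 with hF
  have hFa : ∀ z : ℤ_[ℓ], F.aeval z = z ^ 3 - 3 * z + 1 := fun z => by
    simp only [hF, map_add, map_sub, map_mul, map_pow, aeval_X, map_ofNat, map_one]
  have hF' : ∀ z : ℤ_[ℓ], F.derivative.aeval z = 3 * z ^ 2 - 3 := fun z => by
    simp only [hF, derivative_add, derivative_X_pow, derivative_mul, derivative_ofNat,
      derivative_X, derivative_one, map_sub, map_mul, map_pow, aeval_X, map_ofNat, map_natCast, zero_mul,
      zero_add, mul_one, add_zero]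
    push_cast; ring
  have hn1 : ‖F.aeval (a : ℤ_[ℓ])‖ < 1 := by
    rw [hFa, show (a : ℤ_[ℓ]) ^ 3 - 3 * a + 1 = ((a ^ 3 - 3 * a + 1 : ℤ) : ℤ_[ℓ]) by push_cast; ring,
      PadicInt.norm_int_lt_one_iff_dvd]
    exact h1
  have hn2 : ‖F.derivative.aeval (a : ℤ_[ℓ])‖ = 1 := by
    rw [hF', show (3 : ℤ_[ℓ]) * (a : ℤ_[ℓ]) ^ 2 - 3 = ((3 * a ^ 2 - 3 : ℤ) : ℤ_[ℓ]) by push_cast; ring]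
    refine le_antisymm (PadicInt.norm_le_one _) (not_lt.mp fun hlt => h2 ?_)
    exact (PadicInt.norm_int_lt_one_iff_dvd _).mp hlt
  have hnorm : ‖F.aeval (a : ℤ_[ℓ])‖ < ‖F.derivative.aeval (a : ℤ_[ℓ])‖ ^ 2 := by
    rw [hn2, one_pow]; exact hn1
  obtain ⟨z, hz, -⟩ := hensels_lemma hnorm
  refine ⟨(z : ℚ_[ℓ]), ?_⟩
  rw [hFa] at hz
  exact_mod_cast congrArg ((↑) : ℤ_[ℓ] → ℚ_[ℓ]) hz

/-- **Torsion of `E(K)` is killed by `N_ℓ = #Ẽ(𝔽_ℓ)`** for a prime `ℓ ≥ 3` of good reduction at which `K`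
embeds into `ℚ_ℓ` (a root of `t³ − 3t + 1` in `ℚ_ℓ`): the image of a torsion point `T` in `E(ℚ_ℓ)` is torsion,
`N_ℓ • T ∈ E₁(ℚ_ℓ)` (AEC VII.2.1) and `E₁(ℚ_ℓ)` is torsion-free (AEC IV.6.1 / VII.3.1), so `N_ℓ • T = 0`
(`Point.map` is injective). [cite: SilvermanAEC2009, VII.2.1 and VII.3.1] -/
theorem reductionPointCount_nsmul_eq_zero_of_isOfFinAddOrder
    (W : WeierstrassCurve ℚ) [W.IsElliptic] [W.IsGloballyMinimal]
    (h3 : finrank ℚ K = 3) (hθ : θ ^ 3 - 3 * θ + 1 = 0)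
    (ℓ : ℕ) [Fact ℓ.Prime] (hℓ : ℓ ≠ 2) (hΔ : ¬ (ℓ : ℤ) ∣ minimalDiscriminantInt W)
    (t : ℚ_[ℓ]) (ht : t ^ 3 - 3 * t + 1 = 0)
    {T : (W.baseChange K).toAffine.Point} (hT : IsOfFinAddOrder T) :
    W.reductionPointCount ℓ • T = 0 := by
  obtain ⟨φ, -⟩ := exists_algHom_padic h3 hθ ℓ t ht
  haveI : (W.baseChange ℚ_[ℓ]).IsElliptic := inferInstanceAs (W.map _).IsElliptic
  let ψ : (W.baseChange K).toAffine.Point →+ (W.baseChange ℚ_[ℓ]).toAffine.Point :=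
    Point.map (W' := W) φ
  have hψT : IsOfFinAddOrder (ψ T) := ψ.isOfFinAddOrder hT
  have hker : (W.baseChange ℚ_[ℓ]).IsInReductionKernel (W.reductionPointCount ℓ • ψ T) :=
    W.isInReductionKernel_reductionPointCount_nsmul ℓ hΔ (ψ T)
  have hzero : W.reductionPointCount ℓ • ψ T = 0 :=
    (W.baseChange ℚ_[ℓ]).eq_zero_of_isOfFinAddOrder_of_isInReductionKernel hℓ hker hψT.nsmul
  apply Point.map_injective (W' := W) φ
  rw [map_nsmul, map_zero]
  exact hzero

/-- **Two-prime torsion bound**: with two such primes `ℓ₁, ℓ₂`, a torsion point of `E(K)` is killed by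
`gcd(N_{ℓ₁}, N_{ℓ₂})`. [cite: SilvermanAEC2009, VII.3.1] -/
theorem gcd_nsmul_eq_zero_of_isOfFinAddOrder
    (W : WeierstrassCurve ℚ) [W.IsElliptic] [W.IsGloballyMinimal]
    (h3 : finrank ℚ K = 3) (hθ : θ ^ 3 - 3 * θ + 1 = 0)
    (ℓ₁ : ℕ) [Fact ℓ₁.Prime] (hℓ₁ : ℓ₁ ≠ 2) (hΔ₁ : ¬ (ℓ₁ : ℤ) ∣ minimalDiscriminantInt W)
    (t₁ : ℚ_[ℓ₁]) (ht₁ : t₁ ^ 3 - 3 * t₁ + 1 = 0)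
    (ℓ₂ : ℕ) [Fact ℓ₂.Prime] (hℓ₂ : ℓ₂ ≠ 2) (hΔ₂ : ¬ (ℓ₂ : ℤ) ∣ minimalDiscriminantInt W)
    (t₂ : ℚ_[ℓ₂]) (ht₂ : t₂ ^ 3 - 3 * t₂ + 1 = 0)
    {T : (W.baseChange K).toAffine.Point} (hT : IsOfFinAddOrder T) :
    Nat.gcd (W.reductionPointCount ℓ₁) (W.reductionPointCount ℓ₂) • T = 0 := by
  apply addOrderOf_dvd_iff_nsmul_eq_zero.mp
  exact Nat.dvd_gcd
    (addOrderOf_dvd_iff_nsmul_eq_zero.mpr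
      (reductionPointCount_nsmul_eq_zero_of_isOfFinAddOrder W h3 hθ ℓ₁ hℓ₁ hΔ₁ t₁ ht₁ hT))
    (addOrderOf_dvd_iff_nsmul_eq_zero.mpr
      (reductionPointCount_nsmul_eq_zero_of_isOfFinAddOrder W h3 hθ ℓ₂ hℓ₂ hΔ₂ t₂ ht₂ hT))

end Torsion


/-! ## §3 The `σ`-trick: `r` rational points and `Q − σQ` of infinite order give `r + 2 ≤ rank E(K)` -/

section SigmaTrick

/-- From `r ≤ finrank_ℤ M` an independent family of `r` elements (Mathlib's
`exists_linearIndependent_cons_of_lt_finrank`, iterated). [folklore] -/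
theorem exists_linearIndependent_fin {M : Type} [AddCommGroup M] :
    ∀ r : ℕ, r ≤ Module.finrank ℤ M → ∃ v : Fin r → M, LinearIndependent ℤ v
  | 0, _ => ⟨fun i => Fin.elim0 i, linearIndependent_empty_type⟩
  | r + 1, hr => by
    obtain ⟨v, hv⟩ := exists_linearIndependent_fin r (Nat.le_of_succ_le hr)
    obtain ⟨x, hx⟩ := exists_linearIndependent_cons_of_lt_finrank hv (Nat.lt_of_succ_le hr)
    exact ⟨Fin.cons x v, hx⟩

/-- `3(b² − bc + c²) = 0` over `ℤ` forces `b = c = 0`. [folklore] -/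
theorem eq_zero_of_quadForm_eq_zero {b c : ℤ}
    (h : (b + c) ^ 2 - (b + c) * (2 * c - b) + (2 * c - b) ^ 2 = 0) : b = 0 ∧ c = 0 := by
  have hsq : 3 * ((2 * b - c) ^ 2 + 3 * c ^ 2) = 0 := by linear_combination 4 * h
  have h0 : (2 * b - c) ^ 2 + 3 * c ^ 2 = 0 := (mul_eq_zero.mp hsq).resolve_left (by norm_num)
  have hc2 : c ^ 2 = 0 := by nlinarith [sq_nonneg (2 * b - c), sq_nonneg c]
  have hc : c = 0 := pow_eq_zero_iff (two_ne_zero) |>.mp hc2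
  have hb2 : (2 * b - c) ^ 2 = 0 := by nlinarith [sq_nonneg (2 * b - c), sq_nonneg c]
  have hb : 2 * b - c = 0 := pow_eq_zero_iff (two_ne_zero) |>.mp hb2
  exact ⟨by omega, hc⟩

variable {K : Type} [Field K] [NumberField K]

/-- **The `σ`-trick (F9-FINDING §3, kernel form).** `W/ℚ` elliptic, `K` a number field, `σ : K →ₐ[ℚ] K`
with `σ³ = 1`, acting on `E(K)` by transport of coordinates (`Point.map σ`). If `r ≤ rank_ℤ E(ℚ)` and
`Q ∈ E(K)` has `D = Q − σQ` of infinite order, then `r + 2 ≤ rank_ℤ E(K)`: `r` independent rational points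
together with `D, σD` are `ℤ`-independent (a relation `Σ aᵢPᵢ + bD + cσD = 0` gives `(b+c)D + (2c−b)σD = 0`
after `1 − σ`, then `(x² − xy + y²)D = 0` after `σ` and elimination, `x² − xy + y² = 3(b² − bc + c²)`),
and `E(K)` is finitely generated (Mordell–Weil, tree `module_finite_point_holds`).
[cite: SilvermanAEC2009, Thm. VIII.6.7] -/
theorem add_two_le_mordellWeilRank_of_sigma (W : WeierstrassCurve ℚ) [W.IsElliptic]
    (σ : K →ₐ[ℚ] K) (hσ3 : ∀ x, σ (σ (σ x)) = x) {r : ℕ} (hr : r ≤ W.mordellWeilRank)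
    (Q : (W.baseChange K).toAffine.Point)
    (hD : ¬ IsOfFinAddOrder (Q - Point.map (W' := W.toAffine) σ Q)) :
    r + 2 ≤ (W.baseChange K).mordellWeilRank := by
  haveI : (W.baseChange K).IsElliptic := inferInstanceAs (W.map _).IsElliptic
  haveI : (W.baseChange ℚ).IsElliptic := inferInstanceAs (W.map _).IsElliptic
  haveI : Module.Finite ℤ (W.baseChange K).toAffine.Point := (W.baseChange K).module_finite_point_holds
  -- (the group law on `E(ℚ)` is elaborated here against `instDecidableEqRat`, in the tree lemmas against the
  -- classical instance; the instances are equal (`Subsingleton`), so `convert` crosses over)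
  haveI : Module.Finite ℤ (W.baseChange ℚ).toAffine.Point := by
    convert (W.baseChange ℚ).module_finite_point_holds
  -- `r` independent rational points
  have hr' : r ≤ Module.finrank ℤ (W.baseChange ℚ).toAffine.Point := by
    have e : (W.baseChange ℚ).mordellWeilRank = W.mordellWeilRank := by
      rw [WeierstrassCurve.baseChange_rat]
    rw [← e] at hr
    unfold WeierstrassCurve.mordellWeilRank at hr
    convert hr
  obtain ⟨v, hv⟩ := exists_linearIndependent_fin r hr'
  -- the maps `ι : E(ℚ) → E(K)` and `ρ = σ_*`
  set ι : (W.baseChange ℚ).toAffine.Point →+ (W.baseChange K).toAffine.Point :=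
    Point.baseChange (W' := W.toAffine) ℚ K with hι
  set ρ : (W.baseChange K).toAffine.Point →+ (W.baseChange K).toAffine.Point :=
    Point.map (W' := W.toAffine) σ with hρ
  have hρι : ∀ P, ρ (ι P) = ι P := fun P => Point.map_baseChange (W' := W.toAffine) σ P
  have hρ3 : ∀ P, ρ (ρ (ρ P)) = P := by
    rintro (_ | ⟨x, y, h⟩)
    · rfl
    · rw [hρ, Point.map_some, Point.map_some, Point.map_some]
      obtain ⟨h', e⟩ := exists_some_eq_of_eq (W := W.baseChange K)
        ((W.toAffine.baseChange_nonsingular σ.injective ..).mpr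
          ((W.toAffine.baseChange_nonsingular σ.injective ..).mpr
            ((W.toAffine.baseChange_nonsingular σ.injective ..).mpr h))) (hσ3 x) (hσ3 y)
      exact e
  set D := Q - ρ Q with hDdef
  have hρρD : ρ (ρ D) = -D - ρ D := by
    rw [hDdef, map_sub, map_sub, hρ3]; abel
  -- a relation `x D + y ρD = 0` forces `(x² − xy + y²) D = 0`
  have key : ∀ x y : ℤ, x • D + y • ρ D = 0 → (x ^ 2 - x * y + y ^ 2) • D = 0 := by
    intro x y h
    have h2 : x • ρ D + y • ρ (ρ D) = 0 := by
      have := congrArg ρ h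
      rwa [map_add, map_zsmul, map_zsmul, map_zero] at this
    rw [hρρD] at h2
    calc (x ^ 2 - x * y + y ^ 2) • D
        = (x - y) • (x • D + y • ρ D) - y • (x • ρ D + y • (-D - ρ D)) := by module
      _ = 0 := by rw [h, h2, smul_zero, smul_zero, sub_zero]
  have hDfree : ∀ n : ℤ, n • D = 0 → n = 0 := fun n hn => by
    by_contra hne
    exact hD (isOfFinAddOrder_iff_zsmul_eq_zero.mpr ⟨n, hne, hn⟩)
  -- the family `D, ρD, ι v₁, …, ι v_r`
  let u : Fin (r + 2) → (W.baseChange K).toAffine.Point :=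
    Fin.cons D (Fin.cons (ρ D) (fun i => ι (v i)))
  have hu : LinearIndependent ℤ u := by
    rw [Fintype.linearIndependent_iff]
    intro g hg
    simp only [u, Fin.sum_univ_succ, Fin.cons_zero, Fin.cons_succ, Fin.succ_zero_eq_one] at hg
    set S := ∑ i : Fin r, g i.succ.succ • ι (v i) with hS
    have hρS : ρ S = S := by
      simp only [hS, map_sum, map_zsmul, hρι]
    -- apply `1 − ρ`
    have hgρ : g 0 • ρ D + (g 1 • (-D - ρ D) + S) = 0 := by
      have := congrArg ρ hg
      rwa [map_add, map_add, map_zsmul, map_zsmul, hρS, hρρD, map_zero] at this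
    have h1 : (g 0 + g 1) • D + (2 * g 1 - g 0) • ρ D = 0 := by
      calc (g 0 + g 1) • D + (2 * g 1 - g 0) • ρ D
          = (g 0 • D + (g 1 • ρ D + S)) - (g 0 • ρ D + (g 1 • (-D - ρ D) + S)) := by module
        _ = 0 := by rw [hg, hgρ, sub_zero]
    obtain ⟨hg0, hg1⟩ := eq_zero_of_quadForm_eq_zero (hDfree _ (key _ _ h1))
    -- the rational part
    rw [hg0, hg1, zero_smul, zero_smul, zero_add, zero_add] at hg
    have hS0 : ∑ i : Fin r, g i.succ.succ • v i = 0 := by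
      apply Point.map_injective (W' := W.toAffine) (Algebra.ofId ℚ K)
      rw [map_sum, map_zero]
      simpa only [map_zsmul] using hg
    have hrest := (Fintype.linearIndependent_iff.mp hv) (fun i => g i.succ.succ) hS0
    intro i
    refine Fin.cases hg0 (fun j => ?_) i
    refine Fin.cases hg1 (fun k => ?_) j
    exact hrest k
  have hcard := hu.fintype_card_le_finrank
  rw [Fintype.card_fin] at hcard
  exact hcard

end SigmaTrick

end Summit.BirchSwinnertonDyer.Rank1Residual.Iwasawa.LayerOneRank

end
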